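import Mathlib
import Summits.Ventures.HodgeRepro.Tier4.Target
import Summits.Ventures.HodgeRepro.Tier4.Line3.Defs
import Summits.Ventures.HodgeRepro.Tier4.Line3.DefsLemmas
import Summits.Ventures.HodgeRepro.Tier4.Line3.LocaliserS
import Summits.Ventures.HodgeRepro.Tier4.Line3.GramCongruence
import Summits.Ventures.HodgeRepro.Tier4.Line3.ConjCongruence
import Summits.Ventures.HodgeRepro.Tier4.Line3.Denominator
import Summits.Ventures.HodgeRepro.Tier4.Line3.OffMainOrbit
import Summits.Ventures.HodgeRepro.Tier4.Line3.ClassBoundGauss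

/-!
# Tier4/Line3/RayMinor — the GRAM RAY, the scalar-copy support clause, and the MINOR rung

Blind re-derivation cell `pub-hodge-repro`, Tier 4 «PROVE THE STEP» (README §9–§10), LINE L3, lemma L3.5
`term_dominated`; seat t4-L2-p3 (gen 3).  First module of the RAY ROUTE (bus S13403) — the repair of the invariant
majorant route after the interface finding O-L3-8 (t4-L3-p2 g2 S13369; t4-plan-3 g2's v0.39 design S13393):
`LocS.supp` («support up to the norm-one torus `E′¹`») is unsatisfiable on scalar-symmetric data, the honest clause
is support in the deep balls around ALL scalar copies of the main tuple, and the orbits that survive every depth form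
the GRAM RAY of `xm` (Gram matrix a scalar multiple of `Gram(xm)`).  Everything here is stated on a bare pair
`(level, loc)` — no localiser structure — so that it ports to whatever structure the planner types.

* `SuppU D p xm loc` — plan-3's (R1) verbatim: a finite set `S` of lattices containing `xm`, and every supported line
  tuple has a representative `x ≡ l • xm mod (𝔭 𝔭̄)^N L` with `l ≠ 0`, `l • xm ∈ L`, `L ∈ S`;
* `GramRay xm` — plan-3's (R2) verbatim: the orbits of tuples `y` with `Gram(y) = ρ · Gram(xm)`;
* `gramMinor xm x i j = G_ij(x) G₀₀(xm) − G₀₀(x) G_ij(xm)`, the 2×2 minor in which the scalar `l c(l)` CANCELS;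
  `minorModule L xm = gramSpanL L xm · span(Gram(xm))`, a finitely generated `𝒪`-module;
* **`gram_minor_mem`**: for `x ≡ l • xm mod (𝔭𝔭̄)^N L` with `l • xm ∈ L`, `gramMinor xm x i j ∈ (𝔭𝔭̄)^N • minorModule L xm`
  (`Gram(x) = l c(l) Gram(xm) + E` with `E ∈ (𝔭𝔭̄)^N • gramSpanL L xm` by the landed Gram congruence, and
  `M_ij = E_ij G₀₀ − E₀₀ G_ij`);
* `exists_gramMinor_ne_of_not_mem_gramRay`: off the ray some minor is non-zero (if all vanish, `Gram(x) = (G₀₀(x)/G₀₀(xm)) Gram(xm)`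
  and `x`'s orbit is on the ray — `G₀₀(xm) ≠ 0` by anisotropy);
* **`exists_gram_minor_size`**: ONE `D₀ ≠ 0` for all depths with `N(𝔭)^N ≤ ‖σ D₀‖^d ‖σ M_ij‖^d` at some embedding for
  every supported off-ray tuple — g0's `exists_gram_dev_size` with the minor in place of the deviation (same
  denominator and size rungs, `Denominator.rung_archimedean_size_of_mem_smul`).

No printed input is consumed; nothing here asserts anything about the truth of (P); HC_CM is NOT proved by anyone
in this repository.
-/

set_option autoImplicit false

noncomputable section

namespace Summit.Ventures.HodgeRepro.Tier4.Line3

open Summit.Ventures.HodgeRepro.Tier4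
open Matrix NumberField

/-! ### 0. A product of a smeared member with a member lies in the smeared product module -/

section MulMem

variable {R : Type*} [CommRing R] {E : Type*} [CommRing E] [Algebra R E]

/-- `u * v ∈ I • map₂ (·*·) M₁ M₂` when `u ∈ I • M₁` and `v ∈ M₂`. -/
theorem mul_mem_smul_map₂_mul {I : Ideal R} {M₁ M₂ : Submodule R E} {u v : E} (hu : u ∈ I • M₁) (hv : v ∈ M₂) :
    u * v ∈ I • Submodule.map₂ (LinearMap.mul R E) M₁ M₂ := by
  refine Submodule.smul_induction_on hu (fun r hr n hn => ?_) (fun a b ha hb => ?_)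
  · rw [smul_mul_assoc]
    exact Submodule.smul_mem_smul hr (Submodule.apply_mem_map₂ _ hn hv)
  · rw [add_mul]
    exact Submodule.add_mem _ ha hb

end MulMem

namespace T4Data

variable (X : T4Data)

/-! ### 1. The two clauses of the repair: `SuppU` and `GramRay` -/

/-- **THE SCALAR-COPY SUPPORT CLAUSE** (plan-3 (R1), S13393): a finite set `S` of lattices containing `xm`, and every
line tuple carrying a non-zero coefficient of the depth-`N` localiser has a representative in the depth-`N` ball around
a scalar copy `l • xm ∈ L` of the main tuple, `L ∈ S`.  True of the natural localiser (the local scalars are realised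
by global ones); the old `LocS.supp` is the case `l = 1` up to `E′¹`, which is unsatisfiable (O-L3-8). -/
def SuppU (D : X.ThetaData) (p : IsDedekindDomain.HeightOneSpectrum (RingOfIntegers X.E)) (xm : X.Tuple)
    {level : ℕ → X.Level} (loc : ∀ N, X.Tr (level N)) : Prop :=
  ∃ S : Finset (Submodule (RingOfIntegers X.E) (Fin 3 → X.E)),
    (∀ L ∈ S, X.IsLattice L ∧ ∀ j, xm j ∈ L) ∧
    ∀ N (w : X.LineTuple), X.coefQ D.cf (loc N) (X.rep w) ≠ 0 →
      ∃ (l : X.E) (x : X.Tuple) (L : Submodule (RingOfIntegers X.E) (Fin 3 → X.E)), L ∈ S ∧ l ≠ 0 ∧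
        (∀ j, l • xm j ∈ L) ∧ (∀ j, x j - l • xm j ∈ (p.asIdeal * X.conjIdeal p.asIdeal) ^ N • L) ∧ X.lines x = w

/-- **THE GRAM RAY** of the main tuple (plan-3 (R2)): the orbits of tuples whose Gram matrix is a scalar multiple of
`Gram(xm)` — the main orbit (`ρ = 1`) and all its scalar copies (`ρ = l c(l)`). -/
def GramRay (xm : X.Tuple) : Set X.Orbit :=
  {o | ∃ (y : X.Tuple) (ρ : X.E), X.orbitOf (X.lines y) = o ∧ ∀ i j, X.gram y i j = ρ * X.gram xm i j}

/-- The main orbit lies on the ray. -/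
theorem orbitOf_lines_mem_gramRay (xm : X.Tuple) : X.orbitOf (X.lines xm) ∈ X.GramRay xm :=
  ⟨xm, 1, rfl, fun _ _ => (one_mul _).symm⟩

/-- The ball of `SuppU` in the spelling of `OffMainOrbit.ballIdeal`. -/
theorem mem_ballIdeal_smul_of_suppU (p : IsDedekindDomain.HeightOneSpectrum (RingOfIntegers X.E)) (N : ℕ)
    {L : Submodule (RingOfIntegers X.E) (Fin 3 → X.E)} {v : Fin 3 → X.E}
    (h : v ∈ (p.asIdeal * X.conjIdeal p.asIdeal) ^ N • L) : v ∈ X.ballIdeal p N • L := by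
  rwa [X.conjIdeal_eq_map_cR] at h

/-! ### 2. The minor and its module -/

/-- The 2×2 minor `G_ij(x) G₀₀(xm) − G₀₀(x) G_ij(xm)`: invariant under `x ↦ l • x` up to the scalar `l c(l)` in BOTH
terms, so it vanishes on the scalar copies. -/
def gramMinor (xm x : X.Tuple) (i j : Fin 4) : X.E :=
  X.gram x i j * X.gram xm 0 0 - X.gram x 0 0 * X.gram xm i j

/-- The `𝒪`-span of the Gram entries of `xm`. -/
def gramEntrySpan (xm : X.Tuple) : Submodule (RingOfIntegers X.E) X.E :=
  Submodule.span (RingOfIntegers X.E) (Set.range fun ij : Fin 4 × Fin 4 => X.gram xm ij.1 ij.2)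

/-- The Gram entries of `xm` lie in their span. -/
theorem gram_mem_gramEntrySpan (xm : X.Tuple) (i j : Fin 4) : X.gram xm i j ∈ X.gramEntrySpan xm :=
  Submodule.subset_span ⟨(i, j), rfl⟩

/-- **The minor module** `gramSpanL L xm · span(Gram(xm))`. -/
def minorModule (L : Submodule (RingOfIntegers X.E) (Fin 3 → X.E)) (xm : X.Tuple) :
    Submodule (RingOfIntegers X.E) X.E :=
  Submodule.map₂ (LinearMap.mul (RingOfIntegers X.E) X.E) (X.gramSpanL L xm) (X.gramEntrySpan xm)

/-- The minor module of a finitely generated lattice is finitely generated. -/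
theorem minorModule_fg {L : Submodule (RingOfIntegers X.E) (Fin 3 → X.E)} (hL : L.FG) (xm : X.Tuple) :
    (X.minorModule L xm).FG :=
  Submodule.FG.map₂ _ (X.gramSpanL_fg hL xm) (Submodule.fg_span (Set.finite_range _))

/-! ### 3. The Gram deviation from a scalar copy and the minor congruence -/

/-- The Gram matrix of a scalar copy: `Gram(l • xm) = l c(l) · Gram(xm)`. -/
theorem gram_smul (xm : X.Tuple) (l : X.E) (i j : Fin 4) :
    X.gram (fun j => l • xm j) i j = X.c l * l * X.gram xm i j := by
  unfold gram
  exact X.hform_smul l l (xm i) (xm j)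

/-- **Gram congruence from a scalar copy in the lattice**: for `x ≡ l • xm mod (𝔭𝔭̄)^N L` with `l • xm ∈ L`,
`G_ij(x) − l c(l) G_ij(xm) ∈ (𝔭𝔭̄)^N • gramSpanL L xm` (the landed `hform_sub_mem_smul` at the main tuple `l • xm`,
whose Gram span is contained in that of `xm` because `l • xm ∈ L`). -/
theorem gram_sub_smul_mem (p : IsDedekindDomain.HeightOneSpectrum (RingOfIntegers X.E)) (N : ℕ)
    (L : Submodule (RingOfIntegers X.E) (Fin 3 → X.E)) (xm x : X.Tuple) (l : X.E)
    (hl : ∀ j, l • xm j ∈ L) (hx : ∀ j, x j - l • xm j ∈ X.ballIdeal p N • L) (i j : Fin 4) :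
    X.gram x i j - X.c l * l * X.gram xm i j ∈ X.ballIdeal p N • X.gramSpanL L xm := by
  set xm' : X.Tuple := fun j => l • xm j with hxm'
  have hcx : ∀ j, conjVec X.c (x j - xm' j) ∈ X.ballIdeal p N • conjLattice X.c L := fun j =>
    conjVec_mem_smul_of_involutive X.c X.cR X.algebraMap_cR X.cR_cR p.asIdeal N L (hx j)
  have h1 := hform_sub_mem_smul X.c X.H (RingOfIntegers X.E) (X.ballIdeal p N) L (conjLattice X.c L) xm' x hx hcx i j
  -- the Gram span at `xm' = l • xm` is contained in the Gram span at `xm`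
  have hspan : gramSpan X.c X.H (RingOfIntegers X.E) L (conjLattice X.c L) xm' ≤ X.gramSpanL L xm := by
    unfold gramSpan gramSpanL
    refine Submodule.map₂_le_map₂ ?_ ?_
    · refine sup_le le_sup_left ?_
      refine (Submodule.span_le.mpr ?_).trans le_sup_left
      rintro _ ⟨j, rfl⟩
      exact conjVec_mem_conjLattice X.c (hl j)
    · refine sup_le le_sup_left ?_
      refine (Submodule.span_le.mpr ?_).trans le_sup_left
      rintro _ ⟨j, rfl⟩
      exact hl j
  have h2 := Submodule.smul_mono (le_refl (X.ballIdeal p N)) hspan h1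
  have hG : hform X.c X.H (xm' i) (xm' j) = X.c l * l * X.gram xm i j := X.gram_smul xm l i j
  show hform X.c X.H (x i) (x j) - X.c l * l * X.gram xm i j ∈ _
  rw [← hG]
  exact h2

/-- **THE MINOR CONGRUENCE**: for `x ≡ l • xm mod (𝔭𝔭̄)^N L` with `l • xm ∈ L`, every minor lies in
`(𝔭𝔭̄)^N • minorModule L xm` — the scalar `l c(l)` cancels in `M_ij = E_ij G₀₀ − E₀₀ G_ij`. -/
theorem gram_minor_mem (p : IsDedekindDomain.HeightOneSpectrum (RingOfIntegers X.E)) (N : ℕ)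
    (L : Submodule (RingOfIntegers X.E) (Fin 3 → X.E)) (xm x : X.Tuple) (l : X.E)
    (hl : ∀ j, l • xm j ∈ L) (hx : ∀ j, x j - l • xm j ∈ X.ballIdeal p N • L) (i j : Fin 4) :
    X.gramMinor xm x i j ∈ X.ballIdeal p N • X.minorModule L xm := by
  have hE_ij := X.gram_sub_smul_mem p N L xm x l hl hx i j
  have hE_00 := X.gram_sub_smul_mem p N L xm x l hl hx 0 0
  have hid : X.gramMinor xm x i j =
      (X.gram x i j - X.c l * l * X.gram xm i j) * X.gram xm 0 0 -
        (X.gram x 0 0 - X.c l * l * X.gram xm 0 0) * X.gram xm i j := by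
    unfold gramMinor
    ring
  rw [hid]
  exact Submodule.sub_mem _ (mul_mem_smul_map₂_mul hE_ij (X.gram_mem_gramEntrySpan xm 0 0))
    (mul_mem_smul_map₂_mul hE_00 (X.gram_mem_gramEntrySpan xm i j))

/-! ### 4. Off the ray, some minor is non-zero -/

/-- `G₀₀(xm) ≠ 0` for `xm 0 ≠ 0` (anisotropy). -/
theorem gram_zero_zero_ne_zero (xm : X.Tuple) (h0 : xm 0 ≠ 0) : X.gram xm 0 0 ≠ 0 := fun h =>
  h0 (X.hAn _ h)

/-- `xm 0 ≠ 0` for an independent pair. -/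
theorem xm_zero_ne_zero_of_linearIndependent (xm : X.Tuple) (hab : LinearIndependent X.E ![xm 0, xm 1]) :
    xm 0 ≠ 0 := by
  have := hab.ne_zero 0
  simpa using this

/-- **OFF THE RAY, SOME MINOR IS NON-ZERO**: if every minor vanishes, `Gram(x) = (G₀₀(x)/G₀₀(xm)) · Gram(xm)` and the
orbit of `x` lies on the ray. -/
theorem exists_gramMinor_ne_of_not_mem_gramRay (xm x : X.Tuple) (hG : X.gram xm 0 0 ≠ 0)
    (hne : X.orbitOf (X.lines x) ∉ X.GramRay xm) : ∃ i j, X.gramMinor xm x i j ≠ 0 := by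
  by_contra hall
  apply hne
  refine ⟨x, X.gram x 0 0 / X.gram xm 0 0, rfl, fun i j => ?_⟩
  have hij : X.gramMinor xm x i j = 0 := by
    by_contra h
    exact hall ⟨i, j, h⟩
  unfold gramMinor at hij
  rw [div_mul_eq_mul_div, eq_div_iff hG]
  linear_combination hij

/-! ### 5. The archimedean size of a non-zero minor, uniformly in the depth -/

/-- **THE MINOR RUNG.** For a finite set `S` of finitely generated lattices there is ONE `D₀ ≠ 0` such that, at every
depth `N`, every tuple `x ≡ l • xm mod (𝔭𝔭̄)^N L` (`L ∈ S`, `l • xm ∈ L`) whose orbit is OFF the Gram ray has a minor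
`M_ij` with `N(𝔭)^N ≤ ‖σ D₀‖^d · ‖σ M_ij‖^d` at some embedding `σ` (`d = [E′ : ℚ]`). -/
theorem exists_gram_minor_size (p : IsDedekindDomain.HeightOneSpectrum (RingOfIntegers X.E))
    (S : Finset (Submodule (RingOfIntegers X.E) (Fin 3 → X.E))) (hS : ∀ L ∈ S, L.FG) (xm : X.Tuple)
    (hG : X.gram xm 0 0 ≠ 0) :
    ∃ D₀ : RingOfIntegers X.E, D₀ ≠ 0 ∧ ∀ (N : ℕ) (l : X.E) (x : X.Tuple)
      (L : Submodule (RingOfIntegers X.E) (Fin 3 → X.E)), L ∈ S → (∀ j, l • xm j ∈ L) →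
      (∀ j, x j - l • xm j ∈ X.ballIdeal p N • L) → X.orbitOf (X.lines x) ∉ X.GramRay xm →
      ∃ (i j : Fin 4) (σ : X.E →+* ℂ), ((Ideal.absNorm p.asIdeal : ℝ) ^ N) ≤
        ‖σ D₀‖ ^ Module.finrank ℚ X.E * ‖σ (X.gramMinor xm x i j)‖ ^ Module.finrank ℚ X.E := by
  obtain ⟨D₀, hD₀, hden⟩ := exists_denom_finset S (fun L => X.minorModule L xm) fun L hL => X.minorModule_fg (hS L hL) xm
  refine ⟨D₀, hD₀, fun N l x L hL hl hx hne => ?_⟩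
  obtain ⟨i, j, hij⟩ := X.exists_gramMinor_ne_of_not_mem_gramRay xm x hG hne
  have hmem : X.gramMinor xm x i j ∈ X.ballIdeal p N • X.minorModule L xm := X.gram_minor_mem p N L xm x l hl hx i j
  have hmem' : X.gramMinor xm x i j ∈ p.asIdeal ^ N • X.minorModule L xm :=
    Submodule.smul_mono_left (X.ballIdeal_le p N) hmem
  obtain ⟨σ, hσ⟩ := rung_archimedean_size_of_mem_smul X.E p N hD₀ (hden L hL) hmem' hij
  exact ⟨i, j, σ, hσ⟩

end T4Data

end Summit.Ventures.HodgeRepro.Tier4.Line3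

end
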